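import Summits.ResolutionOfSingularities.ResolutionOfSingularities.Theorems.FrobeniusLadderFInjectiveMacaulayficationProp44SigmaCurves
import Summits.ResolutionOfSingularities.ResolutionOfSingularities.Theorems.FrobeniusLadderFInjectiveMacaulayficationProp44SliceCurveUnconditional
import Literature.AlgebraicGeometry.Resolution.StrictTransformTransverseCurve
import Literature.AlgebraicGeometry.Resolution.StrictTransformGenericPoint
import HarnessLib

/-!
# [CoP1] Prop. 4.4, step 3 — regular transverse curves stay regular and transverse under a curve blowing up

[AI: prover `res-inputs-p-5a` (cell res-hironaka; F-71 census row L2 = skeleton v5.2 `stub_reachTidy`, Phase II of the REACH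
decomposition, design note `plan/inputs/p-5a/L2-REACH-TIDY-DESIGN-p5a-v0.md`). Not a statement of the manuscript under adjudication.
AI-written; AI review is weaker than expert review.]

Cossart–Piltant 2008, proof of Prop. 4.4, p. 10: «By lemma 4.3, we have `s(i+1) ≥ s(i)` (note that under assumption (4) in lemma 4.3,
the strict transform of `Σ` in `X′` is transverse to the exceptional divisor, hence to `Γ′` if all components of `Γ` meet transversally)».
At a stage where every curve of `Σ = {ord ≥ μ}` is regular and any two meet transversally (NO BAD POINT, the output of Phase I,
`exists_seq_regular_transverse`), blow up one of the curves `Y`: upstairs there is again no bad point (`curveStep_noBad`). Ingredients: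
ρ2 `CP2008Prop44.curveStep_curves'` (the curves of `Σ′` are strict transforms of curves of `Σ` off `Y`, or the unique regular `Γ′` over
`Y`), T2c `exists_isRsopPart_strictTransform_of_transverse` / `vanishingIdeal_closure_eq_strictTransformIdeal_of_transverse` (strict
transforms are regular and transverse to the exceptional divisor, res-inputs-p-8a) and the persistence of transversality along the
surjection `𝒪_{X,p} ↠ 𝒪_{X′,q}/𝓘_{C̃,q}` (`sup_stalkIdeal_vanishingIdeal_eq_maximalIdeal_of_surjective`).
[cite: CossartPiltant2008, Prop. 4.4 (proof, p. 10, step 3); Lemma 4.3 (2) (4)]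
-/

-- `Summit.<Summit>.<Sub>.Theorems` with `Sub = Summit` (single-conjunct summit, D-0017)
set_option linter.dupNamespace false

noncomputable section

open CategoryTheory CategoryTheory.Limits AlgebraicGeometry TopologicalSpace IsLocalRing
open Literature.AlgebraicGeometry.Resolution Scheme.IdealSheafData

namespace Summit.ResolutionOfSingularities.ResolutionOfSingularities.Theorems

namespace CP2008Prop44

universe u

/-! ## §1 The curves of `Σ` at a stage without bad points -/

/-- **At a stage without bad points every curve of `Σ` is regular, irreducible, of constant order `μ`, cut out by regular parameter
pairs, and meets every other curve of `Σ` transversally at closed threefold points.** [cite: CossartPiltant2008, Prop. 4.4 (proof, p. 10)] -/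
theorem curve_of_noBad {X : Scheme.{u}} [IsLocallyNoetherian X] (hX : Scheme.IsRegular X) (hX3 : topologicalKrullDim X ≤ 3)
    (J : X.IdealSheafData) {μ : ℕ} (hμ : 1 ≤ μ) (hle : ∀ z, idealOrder J z ≤ μ) (hcodim : ∀ z ∈ J.support, 1 < Order.coheight z)
    {𝒞 : Set (Closeds X)} (h𝒞 : ∀ C, C ∈ 𝒞 ↔ ∃ ζ ∈ maxPoints {z : X | (μ : ℕ∞) ≤ idealOrder J z},
      ¬ IsClosed ({ζ} : Set X) ∧ C = ⟨closure {ζ}, isClosed_closure⟩)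
    (hRT : ∀ x : X, ¬ ∃ C ∈ 𝒞,
      x ∈ (vanishingIdeal C).subschemeι '' (Scheme.regularLocus (vanishingIdeal C).subscheme)ᶜ ∨
      (x ∈ (C : Set X) ∧ ∃ C' ∈ 𝒞, C' ≠ C ∧ x ∈ (C' : Set X) ∧
        stalkIdeal (vanishingIdeal C) x ⊔ stalkIdeal (vanishingIdeal C') x ≠ maximalIdeal (X.presheaf.stalk x)))
    {C : Closeds X} (hC : C ∈ 𝒞) :
    Scheme.IsRegular (vanishingIdeal C).subscheme ∧ IsIrreducible (C : Set X) ∧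
      (∀ y ∈ (C : Set X), idealOrder J y = μ) ∧
      (∀ y ∈ (C : Set X), ∀ hr : IsRegularLocalRing (X.presheaf.stalk y),
        ∃ c : Fin 2 → X.presheaf.stalk y, @IsRsopPart _ _ _ 2 c ∧ Ideal.span (Set.range c) = stalkIdeal (vanishingIdeal C) y) ∧
      (∀ D ∈ 𝒞, D ≠ C → ∀ p ∈ (C : Set X) ∩ (D : Set X),
        stalkIdeal (vanishingIdeal C) p ⊔ stalkIdeal (vanishingIdeal D) p = maximalIdeal (X.presheaf.stalk p) ∧
        ringKrullDim (X.presheaf.stalk p) = 3) := by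
  have hcoh3 : ∀ z : X, Order.coheight z ≤ 3 := (topologicalKrullDim_le_iff_forall_coheight_le X 3).mp hX3
  have hC𝒞 := hC
  obtain ⟨ζ, hζmax, hζcl, rfl⟩ := (h𝒞 C).mp hC
  have hζord : (μ : ℕ∞) ≤ idealOrder J ζ := by simpa only [Set.mem_setOf_eq] using maxPoints_subset _ hζmax
  have hζsupp : ζ ∈ J.support := by
    rw [← one_le_idealOrder_iff]
    exact le_trans (show (1 : ℕ∞) ≤ (μ : ℕ∞) by exact_mod_cast hμ) hζord
  have hcohζ : Order.coheight ζ = 2 := coheight_eq_two_of_not_isClosed hcoh3 (hcodim _ hζsupp) hζcl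
  have hreg : Scheme.IsRegular (vanishingIdeal (⟨closure {ζ}, isClosed_closure⟩ : Closeds X)).subscheme :=
    isRegular_subscheme_of_forall_not_mem _ fun x _ himg => hRT x ⟨_, hC𝒞, Or.inl himg⟩
  refine ⟨hreg, isIrreducible_singleton.closure, fun y hy => ?_, fun y hy hr => ?_, fun D hD hne p hp => ?_⟩
  · haveI := hX y
    exact le_antisymm (hle y) (hζord.trans (idealOrder_le_of_specializes (specializes_iff_mem_closure.mpr hy) J))
  · exact exists_rsopPair_of_mem_curve hX hcoh3 hreg rfl hcohζ hy
  · obtain ⟨hpC, hpD⟩ := hp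
    refine ⟨?_, ?_⟩
    · by_contra hne'
      exact hRT p ⟨_, hC𝒞, Or.inr ⟨hpC, D, hD, hne, hpD, hne'⟩⟩
    · -- `p` is a closed point of codimension `3`
      have hpζ : p ≠ ζ := by
        rintro rfl
        obtain ⟨ζ', hζ'max, -, rfl⟩ := (h𝒞 D).mp hD
        have hζ'ord : (μ : ℕ∞) ≤ idealOrder J ζ' := by simpa only [Set.mem_setOf_eq] using maxPoints_subset _ hζ'max
        have heq : ζ' = p := (mem_maxPoints_iff.mp hζmax).2 ζ' hζ'ord (specializes_iff_mem_closure.mpr hpD)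
        exact hne (by rw [heq])
      rw [ringKrullDim_stalk_eq_coheight, (isClosed_singleton_of_mem_closure_of_ne hcoh3 hcohζ hpC hpζ).1]
      rfl

/-! ## §2 One curve blowing up from a stage without bad points -/

/-- **Dichotomy for the curves upstairs** (Lemma 4.3 (2) (4) via `curveStep_curves'`, plus T2c): after blowing up a curve `Y` of `Σ`
at a stage without bad points, a curve `C′ = cl{η′}` of `Σ′` is EITHER the strict transform of a curve `C ≠ Y` of `Σ` — then it is
regular, transverse to the exceptional divisor, and `𝒪_{X,π q} → 𝒪_{X′,q}/𝓘_{C′,q}` is onto at each of its points — OR it lies over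
`Y`, is regular, and is the only curve of `Σ′` over `Y`. [cite: CossartPiltant2008, Lemma 4.3 (2) (4); Prop. 4.4 (proof, p. 10)] -/
theorem curveStep_dichotomy {X X' : Scheme.{u}} [IsLocallyNoetherian X] [IsLocallyNoetherian X'] (hX : Scheme.IsRegular X)
    (hX3 : topologicalKrullDim X ≤ 3) (J : X.IdealSheafData) {μ : ℕ} (hμ : 1 ≤ μ) (hle : ∀ z, idealOrder J z ≤ μ)
    (hcodim : ∀ z ∈ J.support, 1 < Order.coheight z)
    {𝒞 : Set (Closeds X)} (h𝒞 : ∀ C, C ∈ 𝒞 ↔ ∃ ζ ∈ maxPoints {z : X | (μ : ℕ∞) ≤ idealOrder J z},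
      ¬ IsClosed ({ζ} : Set X) ∧ C = ⟨closure {ζ}, isClosed_closure⟩)
    (hRT : ∀ x : X, ¬ ∃ C ∈ 𝒞,
      x ∈ (vanishingIdeal C).subschemeι '' (Scheme.regularLocus (vanishingIdeal C).subscheme)ᶜ ∨
      (x ∈ (C : Set X) ∧ ∃ C' ∈ 𝒞, C' ≠ C ∧ x ∈ (C' : Set X) ∧
        stalkIdeal (vanishingIdeal C) x ⊔ stalkIdeal (vanishingIdeal C') x ≠ maximalIdeal (X.presheaf.stalk x)))
    {Y : Closeds X} (hY : Y ∈ 𝒞) {π : X' ⟶ X} (hπ : IsBlowup π (vanishingIdeal Y))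
    {η' : X'} (hη' : η' ∈ maxPoints {z : X' | (μ : ℕ∞) ≤ idealOrder (controlledTransform π (vanishingIdeal Y) J μ) z})
    (hη'cl : ¬ IsClosed ({η'} : Set X')) :
    (∃ C ∈ 𝒞, C ≠ Y ∧ π η' ∉ (Y : Set X) ∧ (C : Set X) = closure {π η'} ∧
        closure ({η'} : Set X') = closure (π ⁻¹' ((C : Set X) \ Y)) ∧
        Scheme.IsRegular (vanishingIdeal (⟨closure {η'}, isClosed_closure⟩ : Closeds X')).subscheme ∧
        (∀ q ∈ closure ({η'} : Set X'), π q ∈ (Y : Set X) →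
          stalkIdeal (vanishingIdeal (⟨closure {η'}, isClosed_closure⟩ : Closeds X')) q ⊔
            stalkIdeal ((vanishingIdeal Y).comap π) q = maximalIdeal (X'.presheaf.stalk q)) ∧
        (∀ q ∈ closure ({η'} : Set X'), ∀ z : X'.presheaf.stalk q, ∃ r : X.presheaf.stalk (π q),
          z - (π.stalkMap q).hom r ∈ stalkIdeal (vanishingIdeal (⟨closure {η'}, isClosed_closure⟩ : Closeds X')) q)) ∨
      (closure ({η'} : Set X') ⊆ π ⁻¹' (Y : Set X) ∧
        Scheme.IsRegular (vanishingIdeal (⟨closure {η'}, isClosed_closure⟩ : Closeds X')).subscheme ∧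
        ∀ η'' ∈ maxPoints {z : X' | (μ : ℕ∞) ≤ idealOrder (controlledTransform π (vanishingIdeal Y) J μ) z},
          ¬ IsClosed ({η''} : Set X') → π η'' ∈ (Y : Set X) → η'' = η') := by
  obtain ⟨hYreg, hYirr, hYord, hYcurve, hYtr⟩ := curve_of_noBad hX hX3 J hμ hle hcodim h𝒞 hRT hY
  have hsuppY : ((vanishingIdeal Y).support : Set X) = Y := Scheme.IdealSheafData.coe_support_vanishingIdeal _
  rcases curveStep_curves' hX hX3 J hμ hle hcodim hYreg hYirr hYord hYcurve hπ hη' hη'cl with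
    ⟨hnY, hmax, hcl⟩ | ⟨hclY, hreg', -, huniq⟩
  · left
    -- the curve `C = cl{π η'}` of `Σ` and the hypotheses of T2c for it
    have hCmem : (⟨closure {π η'}, isClosed_closure⟩ : Closeds X) ∈ 𝒞 :=
      (h𝒞 _).mpr ⟨π η', hmax, by
        intro hc
        have heq : π ⁻¹' {π η'} = {η'} := by
          ext q
          simp only [Set.mem_preimage, Set.mem_singleton_iff]
          refine ⟨fun hq => (hπ.existsUnique_preimage_of_not_mem_support ?_).unique hq rfl, fun hq => by rw [hq]⟩
          rw [hsuppY]; exact hnY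
        exact hη'cl (heq ▸ hc.preimage π.continuous), rfl⟩
    have hCY : (⟨closure {π η'}, isClosed_closure⟩ : Closeds X) ≠ Y := by
      intro h
      apply hnY
      rw [← h]
      exact subset_closure (Set.mem_singleton _)
    obtain ⟨hCreg, -, -, hCcurve, hCtr⟩ := curve_of_noBad hX hX3 J hμ hle hcodim h𝒞 hRT hCmem
    have hCreg' : ∀ x ∈ (((⟨closure {π η'}, isClosed_closure⟩ : Closeds X)) : Set X), ∃ c : Fin 2 → X.presheaf.stalk x,
        IsRsopPart c ∧ Ideal.span (Set.range c) =
          stalkIdeal (vanishingIdeal (⟨closure {π η'}, isClosed_closure⟩ : Closeds X)) x :=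
      fun x hx => hCcurve x hx (hX x)
    have htr : ∀ x ∈ (((⟨closure {π η'}, isClosed_closure⟩ : Closeds X)) : Set X) ∩ Y,
        stalkIdeal (vanishingIdeal (⟨closure {π η'}, isClosed_closure⟩ : Closeds X)) x ⊔ stalkIdeal (vanishingIdeal Y) x =
          maximalIdeal _ := fun x hx => (hCtr Y hY hCY.symm x hx).1
    have hdim : ∀ x ∈ (((⟨closure {π η'}, isClosed_closure⟩ : Closeds X)) : Set X) ∩ Y, ringKrullDim (X.presheaf.stalk x) = 3 :=
      fun x hx => (hCtr Y hY hCY.symm x hx).2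
    obtain ⟨hIeq, hI'reg⟩ := vanishingIdeal_closure_eq_strictTransformIdeal_of_transverse hπ hCreg' htr hdim
    have hcl' : closure ({η'} : Set X') =
        closure (π ⁻¹' ((((⟨closure {π η'}, isClosed_closure⟩ : Closeds X)) : Set X) \ Y)) := hcl
    have hCeq : (⟨closure {η'}, isClosed_closure⟩ : Closeds X') =
        ⟨closure (π ⁻¹' ((((⟨closure {π η'}, isClosed_closure⟩ : Closeds X)) : Set X) \ Y)), isClosed_closure⟩ := Closeds.ext hcl'
    refine ⟨_, hCmem, hCY, hnY, rfl, hcl', ?_, fun q hq hqY => ?_, fun q hq z => ?_⟩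
    · rw [hCeq, hIeq]; exact hI'reg
    · rw [hCeq]
      exact (exists_isRsopPart_strictTransform_of_transverse hπ hCreg' htr hdim hX hYreg (hcl' ▸ hq)).2 hqY
    · -- surjectivity `𝒪_{X,π q} ↠ 𝒪_{X',q}/𝓘_{C̃,q}`
      have hq' : q ∈ Set.range (strictTransformIdeal π (vanishingIdeal Y)
          (vanishingIdeal (⟨closure {π η'}, isClosed_closure⟩ : Closeds X))).subschemeι := by
        rw [range_subschemeι, ← hIeq, SetLike.mem_coe, ← SetLike.mem_coe, Scheme.IdealSheafData.coe_support_vanishingIdeal]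
        have hq'' := hq
        rw [hcl'] at hq''
        exact hq''
      obtain ⟨v', rfl⟩ := hq'
      obtain ⟨a, ha⟩ := exists_sub_stalkMap_mem_stalkIdeal_strictTransformIdeal_of_transverse hπ hCreg' htr hdim v' z
      refine ⟨a, ?_⟩
      rw [hCeq, hIeq]
      exact ha
  · right
    refine ⟨?_, hreg', huniq⟩
    refine closure_minimal (Set.singleton_subset_iff.mpr ?_) (Y.isClosed.preimage π.continuous)
    change π η' ∈ (Y : Set X)
    rw [← hclY]
    exact subset_closure (Set.mem_singleton _)

/-- **No bad point upstairs** (`s(i+1) ≥ s(i)` for `s(i) = 3`): after blowing up a curve of `Σ` at a stage without bad points, the new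
stage has no bad point. [cite: CossartPiltant2008, Prop. 4.4 (proof, p. 10, step 3); Lemma 4.3 (2) (4)] -/
theorem curveStep_noBad {X X' : Scheme.{u}} [IsLocallyNoetherian X] [IsLocallyNoetherian X'] (hX : Scheme.IsRegular X)
    (hX3 : topologicalKrullDim X ≤ 3) (J : X.IdealSheafData) {μ : ℕ} (hμ : 1 ≤ μ) (hle : ∀ z, idealOrder J z ≤ μ)
    (hcodim : ∀ z ∈ J.support, 1 < Order.coheight z)
    {𝒞 : Set (Closeds X)} (h𝒞 : ∀ C, C ∈ 𝒞 ↔ ∃ ζ ∈ maxPoints {z : X | (μ : ℕ∞) ≤ idealOrder J z},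
      ¬ IsClosed ({ζ} : Set X) ∧ C = ⟨closure {ζ}, isClosed_closure⟩)
    (hRT : ∀ x : X, ¬ ∃ C ∈ 𝒞,
      x ∈ (vanishingIdeal C).subschemeι '' (Scheme.regularLocus (vanishingIdeal C).subscheme)ᶜ ∨
      (x ∈ (C : Set X) ∧ ∃ C' ∈ 𝒞, C' ≠ C ∧ x ∈ (C' : Set X) ∧
        stalkIdeal (vanishingIdeal C) x ⊔ stalkIdeal (vanishingIdeal C') x ≠ maximalIdeal (X.presheaf.stalk x)))
    {Y : Closeds X} (hY : Y ∈ 𝒞) {π : X' ⟶ X} (hπ : IsBlowup π (vanishingIdeal Y))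
    {𝒞' : Set (Closeds X')} (h𝒞' : ∀ C', C' ∈ 𝒞' ↔
      ∃ ζ ∈ maxPoints {z : X' | (μ : ℕ∞) ≤ idealOrder (controlledTransform π (vanishingIdeal Y) J μ) z},
        ¬ IsClosed ({ζ} : Set X') ∧ C' = ⟨closure {ζ}, isClosed_closure⟩) :
    ∀ x' : X', ¬ ∃ C' ∈ 𝒞',
      x' ∈ (vanishingIdeal C').subschemeι '' (Scheme.regularLocus (vanishingIdeal C').subscheme)ᶜ ∨
      (x' ∈ (C' : Set X') ∧ ∃ C'' ∈ 𝒞', C'' ≠ C' ∧ x' ∈ (C'' : Set X') ∧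
        stalkIdeal (vanishingIdeal C') x' ⊔ stalkIdeal (vanishingIdeal C'') x' ≠ maximalIdeal (X'.presheaf.stalk x')) := by
  have hsuppY : ((vanishingIdeal Y).support : Set X) = Y := Scheme.IdealSheafData.coe_support_vanishingIdeal _
  -- `𝓘_Y 𝒪_{X'} ≤ 𝓘_{Γ}` for a closed `Γ ⊆ π⁻¹ Y`
  have hcomap_le : ∀ {Γ : Closeds X'}, (Γ : Set X') ⊆ π ⁻¹' (Y : Set X) → ∀ q,
      stalkIdeal ((vanishingIdeal Y).comap π) q ≤ stalkIdeal (vanishingIdeal Γ) q := by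
    intro Γ hΓ q
    apply stalkIdeal_mono
    rw [← le_support_iff_le_vanishingIdeal]
    refine SetLike.coe_subset_coe.mp ?_
    rw [support_comap]
    intro z hz
    change π z ∈ ((vanishingIdeal Y).support : Set X)
    rw [hsuppY]
    exact hΓ hz
  have hle𝔪 : ∀ {Γ : Closeds X'} {q : X'}, q ∈ (Γ : Set X') → stalkIdeal (vanishingIdeal Γ) q ≤ maximalIdeal _ :=
    fun {Γ} {q} hq => (mem_support_iff_stalkIdeal_le _ _).mp (by
      rw [← SetLike.mem_coe, Scheme.IdealSheafData.coe_support_vanishingIdeal]; exact hq)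
  rintro x' ⟨C', hC', hbad⟩
  obtain ⟨η', hη'max, hη'cl, rfl⟩ := (h𝒞' C').mp hC'
  have hD' := curveStep_dichotomy hX hX3 J hμ hle hcodim h𝒞 hRT hY hπ hη'max hη'cl
  rcases hbad with himg | ⟨hx'C', C'', hC'', hne, hx'C'', hntr⟩
  · -- a singular point: but every curve upstairs is regular
    rcases hD' with ⟨-, -, -, -, -, -, hreg, -, -⟩ | ⟨-, hreg, -⟩ <;>
      exact forall_not_mem_of_isRegular_subscheme _ hreg x' himg
  · obtain ⟨η'', hη''max, hη''cl, rfl⟩ := (h𝒞' C'').mp hC''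
    have hD'' := curveStep_dichotomy hX hX3 J hμ hle hcodim h𝒞 hRT hY hπ hη''max hη''cl
    apply hntr
    rcases hD' with ⟨C, hC, hCY, -, hCeq, hcl', -, htrE', hsurj'⟩ | ⟨hfib', -, huniq'⟩
    · rcases hD'' with ⟨D, hD, hDY, -, hDeq, hcl'', -, -, -⟩ | ⟨hfib'', -, -⟩
      · -- two strict transforms: transversality persists along `𝒪_{X,p} ↠ 𝒪_{X',x'}/𝓘_{C̃,x'}`
        have hCD : D ≠ C := by
          intro h
          subst h
          exact hne (Closeds.ext (hcl''.trans hcl'.symm))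
        have h₁ : closure ({η'} : Set X') ⊆ π ⁻¹' (C : Set X) :=
          hcl' ▸ closure_minimal (Set.preimage_mono Set.sdiff_subset) (C.isClosed.preimage π.continuous)
        have h₂ : closure ({η''} : Set X') ⊆ π ⁻¹' (D : Set X) :=
          hcl'' ▸ closure_minimal (Set.preimage_mono Set.sdiff_subset) (D.isClosed.preimage π.continuous)
        obtain ⟨-, -, -, -, hCtr⟩ := curve_of_noBad hX hX3 J hμ hle hcodim h𝒞 hRT hC
        exact sup_stalkIdeal_vanishingIdeal_eq_maximalIdeal_of_surjective π
          (D₁' := ⟨closure {η'}, isClosed_closure⟩) (D₂' := ⟨closure {η''}, isClosed_closure⟩) h₁ h₂ hx'C' hx'C''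
          (hsurj' x' hx'C') (hCtr D hD hCD _ ⟨h₁ hx'C', h₂ hx'C''⟩).1
      · -- strict transform and the curve over `Y`: transverse through the exceptional divisor
        have hE := htrE' x' hx'C' (hfib'' hx'C'')
        refine le_antisymm (sup_le (hle𝔪 hx'C') (hle𝔪 hx'C'')) ?_
        calc maximalIdeal (X'.presheaf.stalk x') = _ := hE.symm
          _ ≤ _ := sup_le le_sup_left ((hcomap_le hfib'' x').trans le_sup_right)
    · rcases hD'' with ⟨D, hD, hDY, -, hDeq, hcl'', -, htrE'', -⟩ | ⟨hfib'', -, -⟩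
      · have hE := htrE'' x' hx'C'' (hfib' hx'C')
        refine le_antisymm (sup_le (hle𝔪 hx'C') (hle𝔪 hx'C'')) ?_
        calc maximalIdeal (X'.presheaf.stalk x') = _ := hE.symm
          _ ≤ _ := sup_le le_sup_right ((hcomap_le hfib' x').trans le_sup_left)
      · -- two curves over `Y`: there is only one
        exfalso
        have hmem : π η'' ∈ (Y : Set X) := hfib'' (subset_closure (Set.mem_singleton _))
        exact hne (by rw [huniq' η'' hη''max hη''cl hmem])

end CP2008Prop44

end Summit.ResolutionOfSingularities.ResolutionOfSingularities.Theorems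

end
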